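import Summits.QuantumFields.YangMills.Theorems.BalabanUVNodesK0Gauge152FluxGeometry

/-!
# K0⁶ ROW P11 — THE UNIFORM-FLUX FLOOR OF dag-n07-e's GAUGE-FIXING SENTENCE: `Gauge152OfClassTopStep F N Sup M B₉ a₀ → F.L · M ≤ 26 · B₉`
# (every `N ≥ 2`, every selector `Sup`, every cube letter `M ≥ 1`, every `0 < a₀`): the (152)-constant AS TYPED must grow linearly with the cube side `L·M`

Cell `pub-ymgap`, seat `pub-ymgap-dag-n21-c` g10 (R134 (a) N21 NE7c s1; K0 ROW P11 negative lane of record for the [15]-fact editions and their step sentences).  Filed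
`--kind proof --supports stmt-QuantumFields-20506 --as helper` (K0⁶ `Record13SepCoPRInhabited`).  dag-n07-e g9's RANGE NOTE ∕ ERRATUM (INBOX l.19920, l.≈20060: «the
uniform-flux floor `B₉ ≳ L·M∕4` for `Gauge152OfClassTopStep` … print-compatible») made kernel.  [15] = [Balaban1985Variational], [6] = [Balaban1985RegularSpaces], [I] = [Balaban1987RG1].

THE SENTENCE.  `Gauge152OfClassTopStep F N Sup M B₉ a₀` (`Node00/CriticalOnFibreGauge.lean`, p532575) = [15] (152) p. 301 line 1 (= [6] Thm 2 applied on the collared cube): every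
configuration `U` in the class (2)∕(6)-Top of a separated (2.18) index (plaquettes `< ε_mη_m²`, co-divergence `< ε_mη_m³`, `0 < ε_m ≤ a₀`, comparable both ways) carries on every
non-wrapping `LⁿM`- and `L^{n+1}M`-cube inside `Ω_n` an `SU(N)`-valued gauge `u` and a potential `A` with `U^u = e^{iη_nA}`, `‖A‖ < B₉ε_n`, `‖∇^{η_n}A‖ < B₉ε_n`.
THE INSTANCE (FILE 25A∕25B): the TOP index of length `1` on `F.P K` (`Ω₁ = T_η`; `K` large), constant thresholds `ε_m ≡ ε = min(a₀, 1∕max(B₉,1), πL²∕s²)`, `s = L²M − 1`; the UNIFORM-FLUX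
abelian configuration `U(x, e₁) = D^{x₀}`, `U = 1` elsewhere, `D = diag(e^{iθ₀}, e^{−iθ₀}, 1, …)` with quantised flux `θ₀ = 2πj∕P`, `P = 2L^{m+K}`, `j = ⌊εP∕2πL²⌋ ≥ 2` (so `D^P = 1`:
consistent across the seam; `ε∕2L² ≤ θ₀ ≤ ε∕L²`): every `01`-plaquette is `D` (`dist1 D = 2 sin(θ₀∕2) < εη_m²`), every other plaquette `1`, and the lattice Yang–Mills current
VANISHES — so `U` is in the class at every scale; the [I]-cube of step `1` and index `0` (side `S = L²M < P`) lies in `Ω₁`.  The sentence hands over `u`, `A` on it; the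
holonomy of `U` around the `s × s` square in the `01`-plane from `π(0)` is `D^{s²}` (abelian Stokes), that of `U^u` is `u(π0)·D^{s²}·u(π0)⁻¹` — a product of `4s` factors
`e^{iη₁A(b)}` each within `2η₁B₉ε` of `1` — so `(2∕π)·s²θ₀ ≤ dist1 (D^{s²}) ≤ 8s·η₁·B₉·ε` (Jordan's inequality; `s²θ₀ ≤ π`), i.e. `s ≤ 8π·L·B₉`.

WHAT THIS FILE PROVES (theorems only; no `def`).
* `exists_flux_scale` — the arithmetic of the instance (`K`, `j`, `ε`, `θ₀` with all the letters above), division-free.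
* ★ `dist1_pow_sq_le_of_gauge152OfClassTopStep` — the instance half: `0 < B₉` and `dist1 (D^{s²}) ≤ 4s·2η₁B₉ε` from the sentence.
* ★★ `sq_L_mul_sub_one_le_of_gauge152OfClassTopStep (hN : 2 ≤ N) (hM : 1 ≤ M) (ha₀ : 0 < a₀) (h : Gauge152OfClassTopStep F N Sup M B₉ a₀) : L²M − 1 ≤ 8π·L·B₉`;
  ★★ `L_mul_le_of_gauge152OfClassTopStep : F.L · M ≤ 26 · B₉`; `not_gauge152OfClassTopStep_of_lt` (`26·B₉ < L·M ⇒ ¬`; e.g. every `B₉ < L∕2`).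
READING.  PRINT-COMPATIBLE — a LETTER, not a defect: [15] (9)∕(152) carry the constant `B₃·M` resp. `O(1)·LM·B` on cubes of side `M` resp. `LM` (the potential of a uniform field
grows linearly across the cube), and n07-e's `B₉` absorbs it «per M»; the floor says the absorption cannot be uniform in `L·M`.  For node00-def-P11's v1.1 bridge
`…GaugeRegSepTop7M_of_gauge9TopStep` ∘ n07-e's `gauge9RegSepTopStep_of_prop8TopStep_of_gauge152` (`B₃' = B₉·B₃`) it combines with this lineage's `2L² ≤ B₃` to `B₃' ≳ L³M∕13` on
that road — a letter for the numerics of any consumer FIXING `B₃'` (node00-def-K0a keeps it free).  Companion floors: `0 < B₉` (FILE 24D `pos_of_gauge152OfClassTopStep`).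

HONEST FRAMING: a kernel floor on a TREE-typed named fact (`Prop` with parameters, never asserted); nothing of Bałaban asserted or refuted; K0⁶ neither discharged nor refuted; N21
NOT discharged; NE7c NOT PRINTED ∕ NOT PROVED; counts unmoved (typed 28∕28 · discharged 5∕28); one finite `𝕋⁴` torus family at fixed `ε = L^{−K}`; not continuum ∕ OS ∕ mass gap ∕
Clay.  THEOREMS ONLY: no `def`, `instance`, `notation`, `sorry`; standard axioms; default heartbeats (the proof is split in three declarations for that reason).
DEPENDENCES (by name): FILE 25A `K0UniformFluxConfig.*` (p540675), FILE 25B `K0Gauge152FluxGeometry.*`, FILE 24B `K0TopIndexWrapGeometry.exists_seq_top ∕ zero_mem_cubeIndices`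
(p537040), FILE 24C `K0VariationalThm1GaugeWrap.norm_expI_sub_one_le ∕ eta_nonneg_le_one` (p538870), dag-n07-e `Gauge152OfClassTopStep ∕ dist1_su_eq_norm` (p532575), node00-def-P11
`Record12BgRowGaugeAxial.gaugeU_ιSU`, `Sect2.regionOfSet`, NODE 00 `numerics7OfRecord₁₂ ∕ ιSU ∕ coe_ιSU`, `T4Continuum.holAt_gaugeAct_walk ∕ walkEnd_eq_self_of_netDisp`,
`T4ReflectionCone.rectWord ∕ netDisp_rectWord`, `T4Family.sitesPerDir_tendsto`, Mathlib `Real.mul_le_sin ∕ Real.sin_lt ∕ Real.sin_nat_mul_pi ∕ Real.pi_lt_d2`.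
-/

noncomputable section

open scoped Matrix.Norms.L2Operator

namespace Summit.QuantumFields.YangMills.Theorems.K0Gauge152FluxFloor

open Literature.MathematicalPhysics.QuantumFieldTheory.Balaban1983to89
open Literature.MathematicalPhysics.QuantumFieldTheory.Balaban1983to89.Node00
open Literature.MathematicalPhysics.QuantumFieldTheory.Balaban1983to89.T4Continuum
open B15Eq112TorusCover B14DomainGeom B15DeterminingSets B12RegularSpaces111
open Summit.QuantumFields.YangMills.Theorems.K0BgProvisoOverRange (shift_cover)
open Summit.QuantumFields.YangMills.Theorems.K0TopIndexWrapGeometry (exists_seq_top zero_mem_cubeIndices)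
open Summit.QuantumFields.YangMills.Theorems.K0VariationalThm1GaugeWrap (norm_expI_sub_one_le eta_nonneg_le_one)
open Summit.QuantumFields.YangMills.Theorems.K0UniformFluxConfig

open Summit.QuantumFields.YangMills.Theorems.K0Gauge152FluxGeometry

/-! ## §3  ★★ THE FLUX FLOOR `F.L · M ≤ 26 · B₉` of `Gauge152OfClassTopStep` -/
section Floor

variable {F : T4Family} {N : ℕ} [NeZero N]

/-- **THE SCALES OF THE FLUX INSTANCE** (pure arithmetic): for every `M ≥ 1`, `0 < a₀`, `β ≥ 1` there are a torus exponent `K`, a flux number `j`, a threshold `ε` and an angle `θ₀`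
with `0 < ε ≤ a₀`, `βε ≤ 1`, the `L²M`-cube NOT wrapping on `F.P K` (`L²M < P = sitesPerDir 0`), `θ₀·P = 2πj` (quantised flux: `D_{θ₀}^P = 1`), `0 < θ₀`, `θ₀L² ≤ ε ≤ 2θ₀L²`
(the flux per plaquette sits just below the class threshold `εη₁²`), and `s²θ₀ ≤ π` for `s = L²M − 1` (the square's total flux stays in Jordan's range). [folklore] -/
theorem exists_flux_scale (F : T4Family) {M : ℕ} (hM : 1 ≤ M) {a₀ β : ℝ} (ha₀ : 0 < a₀) (hβ : 1 ≤ β) :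
    ∃ (K j : ℕ) (ε θ₀ : ℝ), 0 < ε ∧ ε ≤ a₀ ∧ β * ε ≤ 1 ∧ F.L ^ 2 * M < (F.P K).sitesPerDir 0 ∧
      θ₀ * (F.P K).sitesPerDir 0 = 2 * Real.pi * j ∧ 0 < θ₀ ∧ θ₀ * (F.L : ℝ) ^ 2 ≤ ε ∧ ε ≤ θ₀ * (2 * (F.L : ℝ) ^ 2) ∧
      ((F.L ^ 2 * M - 1 : ℕ) : ℝ) ^ 2 * θ₀ ≤ Real.pi := by
  have hL13 : 13 ≤ F.L := by obtain ⟨hodd, _⟩ := F.hL; have := F.hL11; rcases hodd with ⟨r, hr⟩; omega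
  have hLR : (13 : ℝ) ≤ F.L := by exact_mod_cast hL13
  have hLpos : (0 : ℝ) < F.L := by linarith
  have hLsq : (0 : ℝ) < (F.L : ℝ) ^ 2 := by positivity
  have hπ := Real.pi_pos
  set S : ℕ := F.L ^ 2 * M with hSdef
  have hS : 169 ≤ S := by rw [hSdef]; nlinarith [hL13, hM]
  set s : ℕ := S - 1 with hsdef
  have hs1 : 1 ≤ s := by omega
  have hspos : (0 : ℝ) < s := by exact_mod_cast hs1
  have hβpos : 0 < β := by linarith
  -- the threshold
  obtain ⟨ε, hε⟩ : ∃ ε : ℝ, ε = min a₀ (min (1 / β) (Real.pi * (F.L : ℝ) ^ 2 / (s : ℝ) ^ 2)) := ⟨_, rfl⟩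
  have hεpos : 0 < ε := by rw [hε]; exact lt_min ha₀ (lt_min (by positivity) (by positivity))
  have hεa₀ : ε ≤ a₀ := by rw [hε]; exact min_le_left _ _
  have hεβ : ε ≤ 1 / β := by rw [hε]; exact (min_le_right _ _).trans (min_le_left _ _)
  have hεs : ε ≤ Real.pi * (F.L : ℝ) ^ 2 / (s : ℝ) ^ 2 := by rw [hε]; exact (min_le_right _ _).trans (min_le_right _ _)
  have hεs' : ε * (s : ℝ) ^ 2 ≤ Real.pi * (F.L : ℝ) ^ 2 := by
    have := hεs; rwa [le_div_iff₀ (by positivity)] at this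
  have hβε : β * ε ≤ 1 := by
    calc β * ε ≤ β * (1 / β) := mul_le_mul_of_nonneg_left hεβ hβpos.le
      _ = 1 := by field_simp
  -- the torus `F.P K`: `P = sitesPerDir 0 ≥ S + 1` and `εP ≥ 4πL²`
  obtain ⟨K, hK⟩ : ∃ K : ℕ, S + 1 + ⌈4 * Real.pi * (F.L : ℝ) ^ 2 / ε⌉₊ ≤ (F.P K).sitesPerDir 0 :=
    (Filter.tendsto_atTop.1 F.sitesPerDir_tendsto _).exists
  set Per : ℕ := (F.P K).sitesPerDir 0 with hPer
  have hPerS : S < Per := by have := Nat.le_ceil (4 * Real.pi * (F.L : ℝ) ^ 2 / ε); omega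
  have hPerpos : 0 < Per := by omega
  have hPerR : (0 : ℝ) < Per := by exact_mod_cast hPerpos
  have hPerε' : 4 * Real.pi * (F.L : ℝ) ^ 2 ≤ ε * Per := by
    have h1 := Nat.le_ceil (4 * Real.pi * (F.L : ℝ) ^ 2 / ε)
    have h2 : (⌈4 * Real.pi * (F.L : ℝ) ^ 2 / ε⌉₊ : ℝ) ≤ Per := by exact_mod_cast (show ⌈4 * Real.pi * (F.L : ℝ) ^ 2 / ε⌉₊ ≤ Per by omega)
    have h3 : 4 * Real.pi * (F.L : ℝ) ^ 2 / ε ≤ Per := by linarith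
    rw [div_le_iff₀ hεpos] at h3; linarith
  -- the flux number `j = ⌊εP/(2πL²)⌋ ≥ 2` and the angle `θ₀ = 2πj/P`
  have hc2 : (0 : ℝ) < 2 * Real.pi * (F.L : ℝ) ^ 2 := by positivity
  obtain ⟨x, hx⟩ : ∃ x : ℝ, x * (2 * Real.pi * (F.L : ℝ) ^ 2) = ε * Per :=
    ⟨ε * Per / (2 * Real.pi * (F.L : ℝ) ^ 2), div_mul_cancel₀ _ (ne_of_gt hc2)⟩
  have hx2 : 2 ≤ x := by
    by_contra hlt
    rw [not_le] at hlt
    nlinarith [mul_pos (sub_pos.2 hlt) hc2]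
  set j : ℕ := ⌊x⌋₊ with hj
  have hjx : (j : ℝ) ≤ x := Nat.floor_le (by linarith)
  have hjx' : x / 2 ≤ j := by
    have h1 := Nat.lt_floor_add_one x
    have h2 : x - 1 < j := by linarith
    linarith
  obtain ⟨θ₀, hθ₀⟩ : ∃ θ : ℝ, θ = 2 * Real.pi * j / Per := ⟨_, rfl⟩
  have hθP : θ₀ * Per = 2 * Real.pi * j := by rw [hθ₀]; exact div_mul_cancel₀ _ (ne_of_gt hPerR)
  have hjpos : (0 : ℝ) < j := by linarith
  have hθ₀pos : 0 < θ₀ := by rw [hθ₀]; positivity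
  have hθL : θ₀ * (F.L : ℝ) ^ 2 ≤ ε := by
    have h4 : θ₀ * Per * (F.L : ℝ) ^ 2 = 2 * Real.pi * j * (F.L : ℝ) ^ 2 := by rw [hθP]
    have h5 : 2 * Real.pi * (F.L : ℝ) ^ 2 * j ≤ 2 * Real.pi * (F.L : ℝ) ^ 2 * x := mul_le_mul_of_nonneg_left hjx hc2.le
    have h1 : θ₀ * (F.L : ℝ) ^ 2 * Per ≤ ε * Per := by
      have e : θ₀ * (F.L : ℝ) ^ 2 * Per = θ₀ * Per * (F.L : ℝ) ^ 2 := by ring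
      rw [e, h4]; linarith
    exact le_of_mul_le_mul_right h1 hPerR
  have hθL' : ε ≤ θ₀ * (2 * (F.L : ℝ) ^ 2) := by
    have h6 : x * (2 * Real.pi * (F.L : ℝ) ^ 2) ≤ (2 * j) * (2 * Real.pi * (F.L : ℝ) ^ 2) :=
      mul_le_mul_of_nonneg_right (by linarith) hc2.le
    have h1 : ε * Per ≤ θ₀ * (2 * (F.L : ℝ) ^ 2) * Per := by
      have e : θ₀ * (2 * (F.L : ℝ) ^ 2) * Per = 2 * (θ₀ * Per) * (F.L : ℝ) ^ 2 := by ring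
      rw [e, hθP, ← hx]; linarith
    exact le_of_mul_le_mul_right h1 hPerR
  have hsθ : (s : ℝ) ^ 2 * θ₀ ≤ Real.pi := by
    have h7 : (s : ℝ) ^ 2 * (θ₀ * (F.L : ℝ) ^ 2) ≤ (s : ℝ) ^ 2 * ε := mul_le_mul_of_nonneg_left hθL (sq_nonneg _)
    have h1 : (s : ℝ) ^ 2 * θ₀ * (F.L : ℝ) ^ 2 ≤ Real.pi * (F.L : ℝ) ^ 2 := by
      have e : (s : ℝ) ^ 2 * θ₀ * (F.L : ℝ) ^ 2 = (s : ℝ) ^ 2 * (θ₀ * (F.L : ℝ) ^ 2) := by ring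
      rw [e]; linarith
    exact le_of_mul_le_mul_right h1 hLsq
  exact ⟨K, j, ε, θ₀, hεpos, hεa₀, hβε, hPerS, hθP, hθ₀pos, hθL, hθL', hsθ⟩

/-- **THE HANDED-OVER GAUGE READS THE SQUARE'S FLUX** (the instance half): on `F.P K` with the `L²M`-cube not wrapping, for `D ∈ SU(N)` with `D^P = 1` whose distance from `1` is
below the class threshold `ε∕L² = εη₁²` (`0 < ε ≤ a₀`, `B₉ε ≤ 1` when `B₉ > 0`), the uniform-flux configuration is in the class (2)∕(6)-Top of `Gauge152OfClassTopStep` at the TOP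
index of length `1`, and the gauge it hands over on the [I]-cube of index `0` gives `0 < B₉` and `dist1 (D^{s²}) ≤ 4s·2η₁B₉ε`, `s = L²M − 1` (the square's holonomy conjugated by
`u(π0)`, FILE 25A `holAt_flux_rectWord`, every one of its `4s` bond factors within `2η₁B₉ε` of `1`).
[cite: Balaban1985Variational, (144)–(153) pp.300–301; Balaban1985RegularSpaces, Thm 2 pp.82–83, (1.9) p.77; Balaban1987RG1, (1.12) p.262] -/
theorem dist1_pow_sq_le_of_gauge152OfClassTopStep (hN : 2 ≤ N) {Sup : (ν : Stage7Numerics) → (K : ℕ) → (ℕ → Set (Site (F.P K) 0)) → Set (Site (F.P K) 0)}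
    {M : ℕ} (hM : 1 ≤ M) {B₉ a₀ : ℝ} (h : Gauge152OfClassTopStep F N Sup M B₉ a₀) (K : ℕ) {ε : ℝ} (hεpos : 0 < ε) (hεa₀ : ε ≤ a₀)
    (hBε : max B₉ 1 * ε ≤ 1) (hSP : F.L ^ 2 * M < (F.P K).sitesPerDir 0) {D : SU N} (hDP : D ^ (F.P K).sitesPerDir 0 = 1)
    (hdistD : dist1 D < ε / (F.L : ℝ) ^ 2) :
    0 < B₉ ∧ dist1 (D ^ ((F.L ^ 2 * M - 1) * (F.L ^ 2 * M - 1))) ≤ ((4 * (F.L ^ 2 * M - 1) : ℕ) : ℝ) * (2 * ((F.P K).eta 1 * (B₉ * ε))) := by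
  classical
  have _hN := hN
  set P : Params := F.P K with hPdef
  have hPd : P.d = 4 := T4Family.P_d F K
  have hPL : P.L = F.L := T4Family.P_L F K
  have hL13 : 13 ≤ F.L := by obtain ⟨hodd, _⟩ := F.hL; have := F.hL11; rcases hodd with ⟨r, hr⟩; omega
  set S : ℕ := F.L ^ 2 * M with hSdef
  have hS : 169 ≤ S := by rw [hSdef]; nlinarith [hL13, hM]
  set s : ℕ := S - 1 with hsdef
  have hsS : s + 1 ≤ S := by omega
  have hsPer : s < P.sitesPerDir 0 := by omega
  -- the uniform-flux configuration
  set μ₁ : Fin P.d := ⟨0, by rw [hPd]; norm_num⟩ with hμ₁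
  set μ₂ : Fin P.d := ⟨1, by rw [hPd]; norm_num⟩ with hμ₂
  have h12 : μ₁ < μ₂ := Fin.mk_lt_mk.2 (by norm_num)
  have hne : μ₁ ≠ μ₂ := ne_of_lt h12
  set U : GaugeField P 0 (SU N) := fun b => if b.dir = μ₂ then D ^ (b.src μ₁).val else 1 with hUdef
  have hU : ∀ b, U b = if b.dir = μ₂ then D ^ (b.src μ₁).val else 1 := fun _ => rfl
  -- class (2)/(6)-Top at thresholds `ε_m ≡ ε`
  have hLpos : (0 : ℝ) < F.L := by exact_mod_cast (show 0 < F.L by omega)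
  have hη1 : P.eta 1 = ((F.L : ℝ))⁻¹ := by rw [Params.eta, hPL, pow_one]
  have hη : ∀ m, m ≤ 1 → ε / (F.L : ℝ) ^ 2 ≤ ε * P.eta m ^ 2 := by
    intro m hm
    rcases Nat.le_one_iff_eq_zero_or_eq_one.1 hm with rfl | rfl
    · rw [Params.eta, pow_zero, one_pow, mul_one]
      have hL1 : (1 : ℝ) ≤ F.L := by exact_mod_cast (show 1 ≤ F.L by omega)
      exact div_le_self hεpos.le (by nlinarith)
    · rw [hη1, inv_pow, div_eq_mul_inv]
  have hηpos : ∀ m, 0 < P.eta m := fun m => by rw [Params.eta, hPL]; positivity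
  obtain ⟨sq, hΩ, hsep⟩ := exists_seq_top F numerics7OfRecord₁₂ hM (fun _ => (1 : ℝ)) K 1
  have hplaq : ∀ m, m ≤ 1 → PlaqSmallOn (Sect2.omegaPlaqsTop sq.Ω (Sup numerics7OfRecord₁₂ K sq.Ω) m) (ε * P.eta m ^ 2) U :=
    fun m hm q _ => ((dist1_plaqHol_flux_le h12 hDP hU q).trans_lt hdistD).trans_le (hη m hm)
  have hcodiv : ∀ m, m ≤ 1 → Sect2.CoDivSmallOn (Sect2.omegaBondsTop sq.Ω (Sup numerics7OfRecord₁₂ K sq.Ω) m) (ε * P.eta m ^ 3) U :=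
    fun m _ => coDivSmallOn_flux h12 hDP hU _ (mul_pos hεpos (pow_pos (hηpos m) 3))
  -- the [I]-cube of step 1, index 0: side `S = L²M`, non-wrapping, inside `Ω₁ = T_η`
  have hside : B14.Eq213MaximalDomains.side P.L M (1 + 1) = S := by rw [B14.Eq213MaximalDomains.side, hPL, hSdef]
  have hSN : ((B14.Eq213MaximalDomains.side P.L M (1 + 1) : ℕ) : ℤ) < P.sitesPerDir 0 := by rw [hside]; exact_mod_cast hSP
  have hS0 : 0 < B14.Eq213MaximalDomains.side P.L M (1 + 1) := by rw [hside]; omega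
  have hcube : cubeEnl P (B14.Eq213MaximalDomains.side P.L M (1 + 1)) 0 0 ⊆ sq.Ω 1 := by rw [hΩ 1 le_rfl le_rfl]; exact Set.subset_univ _
  -- apply the sentence
  obtain ⟨u, A, hgauge, hA, -⟩ := h numerics7OfRecord₁₂ (fun _ => (1 : ℝ)) K 1 sq hsep (by change (0 : ℕ) < 1; exact Nat.one_pos) le_rfl
    (fun _ => ε) (fun _ _ => ⟨hεpos, hεa₀⟩) (fun _ _ => by linarith) (fun _ _ => by linarith) U hplaq hcodiv 1 le_rfl le_rfl _ (Or.inr rfl) hSN 0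
    (zero_mem_cubeIndices hS0) hcube
  rw [hside] at hgauge hA
  -- `0 < B₉` from the bond `⟨π(0), e₀⟩` of the cube
  have hb0 : (⟨cover P 0, μ₁⟩ : PBond P 0) ∈ (Sect2.regionOfSet P (cubeEnl P S 0 0)).bonds := by
    refine ⟨cover_mem_cubeEnl_zero_of_box fun κ => by simp; omega, ?_⟩
    show (cover P 0).shift μ₁ ∈ _
    rw [shift_cover]
    exact cover_mem_cubeEnl_zero_of_box fun κ => by
      by_cases hk : κ = μ₁
      · subst hk; simp; omega
      · simp [Function.update_of_ne hk]; omega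
  have hB₉pos : 0 < B₉ := by
    have h1 := hA _ hb0
    have h0 := norm_nonneg (A ⟨cover P 0, μ₁⟩)
    by_contra hB; rw [not_lt] at hB
    have : B₉ * ε ≤ 0 := mul_nonpos_of_nonpos_of_nonneg hB hεpos.le
    linarith
  have hB₉ε : B₉ * ε ≤ 1 := le_trans (mul_le_mul_of_nonneg_right (le_max_left _ _) hεpos.le) hBε
  -- per-bond estimate in the handed-over gauge along the square
  obtain ⟨hη0, hη1le⟩ := eta_nonneg_le_one P 1
  have hbonds := bonds_rectWord_subset (P := P) hne (s := s) (S := S) hsS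
  have hstep : ∀ st ∈ walk (cover P 0) (T4ReflectionCone.rectWord μ₁ μ₂ s s), dist1 (GaugeField.gaugeAct u U st.bond) ≤ 2 * (P.eta 1 * (B₉ * ε)) := by
    intro st hst
    have hb := hbonds st hst
    have h1 := hgauge _ hb
    rw [gaugeU_ιSU] at h1
    rw [dist1_su_eq_norm, ← coe_ιSU, h1]
    have hAb := (hA _ hb).le
    have hAt : P.eta 1 * ‖A st.bond‖ ≤ 1 :=
      calc P.eta 1 * ‖A st.bond‖ ≤ 1 * (B₉ * ε) := mul_le_mul hη1le hAb (norm_nonneg _) zero_le_one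
        _ ≤ 1 := by rw [one_mul]; exact hB₉ε
    exact (norm_expI_sub_one_le hη0 hAt).trans (by gcongr)
  -- the two readings of the square's holonomy
  have hhol : holAt U (walk (cover P 0) (T4ReflectionCone.rectWord μ₁ μ₂ s s)) = D ^ (s * s) :=
    holAt_flux_rectWord h12 hU (by simp) hsPer
  have hclosed : walkEnd (cover P 0) (T4ReflectionCone.rectWord μ₁ μ₂ s s) = cover P 0 :=
    walkEnd_eq_self_of_netDisp fun ν => by rw [T4ReflectionCone.netDisp_rectWord, Int.cast_zero]
  have hgaugehol : holAt (GaugeField.gaugeAct u U) (walk (cover P 0) (T4ReflectionCone.rectWord μ₁ μ₂ s s)) =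
      u (cover P 0) * D ^ (s * s) * (u (cover P 0))⁻¹ := by
    rw [holAt_gaugeAct_walk, hhol, hclosed]
  have hlen : (walk (cover P 0) (T4ReflectionCone.rectWord μ₁ μ₂ s s)).length = 4 * s := by
    rw [length_walk]; simp [T4ReflectionCone.rectWord]; ring
  have h1 := dist1_holAt_le_length_mul (GaugeField.gaugeAct u U) _ hstep
  rw [hgaugehol, GaugeGroup.dist1_conj, hlen] at h1
  exact ⟨hB₉pos, h1⟩

/-- **★★ THE UNIFORM-FLUX FLOOR OF dag-n07-e's GAUGE-FIXING SENTENCE** ([15] (152) p. 301 line 1 = [6] Thm 2 applied on the collared cube, typed as `Gauge152OfClassTopStep F N Sup M B₉ a₀`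
in `Node00/CriticalOnFibreGauge.lean`): for every torus family `F`, `N ≥ 2`, selector `Sup`, cube letter `M ≥ 1` and `0 < a₀`, the sentence forces `L²M − 1 ≤ 8π·L·B₉`.
INSTANCE (dag-n07-e's «uniform flux» engine, INBOX l.19990 ∕ ERRATUM l.≈20060, made kernel): the TOP index of length `k = 1` on `F.P K` (`K` large), thresholds `ε_m ≡ ε =
min(a₀, 1∕max(B₉,1), πL²∕s²)` with `s = L²M − 1`, the uniform-flux abelian configuration `U(x, e₁) = D^{x₀}` (FILE 25A) with `D = diag(e^{iθ₀}, e^{−iθ₀}, 1, …)`,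
`θ₀ = 2πj∕P ∈ [ε∕2L², ε∕L²]`, `P = 2L^{m+K}`, `D^P = 1`: it lies in the class (2)∕(6)-Top (plaquettes `2 sin(θ₀∕2) < εη_m²`, Yang–Mills current `0`); the [I]-cube of step `1` and index
`0` (side `S = L²M < P`) lies in `Ω₁ = T_η`; the handed-over gauge `u`, `A` (`U^u = e^{iη₁A}`, `‖A‖ < B₉ε` on the cube) conjugates the holonomy `D^{s²}` of the `s × s` square in the cube
by `u(π0)`, so `(2∕π)·s²θ₀ ≤ dist1 (D^{s²}) ≤ 4s·2η₁B₉ε` (Jordan's inequality on the left, `‖e^Y − 1‖ ≤ 2‖Y‖` per bond on the right), i.e. `s ≤ 8πLB₉`.  Print-COMPATIBLE: print's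
constant in (9)∕(152) is `B₃·LM` (the potential of a uniform field grows linearly across the cube); so this is a LETTER for the numerics of any consumer fixing `B₉`, not a defect.
[cite: Balaban1985Variational, Thm 1 (9) p.279, (144)–(153) pp.300–301; Balaban1985RegularSpaces, Thm 2 pp.82–83, (1.9) p.77; Balaban1987RG1, (1.12) p.262] -/
theorem sq_L_mul_sub_one_le_of_gauge152OfClassTopStep (hN : 2 ≤ N) {Sup : (ν : Stage7Numerics) → (K : ℕ) → (ℕ → Set (Site (F.P K) 0)) → Set (Site (F.P K) 0)}
    {M : ℕ} (hM : 1 ≤ M) {B₉ a₀ : ℝ} (ha₀ : 0 < a₀) (h : Gauge152OfClassTopStep F N Sup M B₉ a₀) :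
    ((F.L : ℝ) ^ 2 * M - 1) ≤ 8 * Real.pi * F.L * B₉ := by
  have hL13 : 13 ≤ F.L := by obtain ⟨hodd, _⟩ := F.hL; have := F.hL11; rcases hodd with ⟨r, hr⟩; omega
  have hLR : (13 : ℝ) ≤ F.L := by exact_mod_cast hL13
  have hLpos : (0 : ℝ) < F.L := by linarith
  have hπ := Real.pi_pos
  set S : ℕ := F.L ^ 2 * M with hSdef
  have hS : 169 ≤ S := by rw [hSdef]; nlinarith [hL13, hM]
  set s : ℕ := S - 1 with hsdef
  have hsS : s + 1 = S := by omega
  have hs1 : 1 ≤ s := by omega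
  have hsR : (s : ℝ) = (F.L : ℝ) ^ 2 * M - 1 := by
    have e : ((s + 1 : ℕ) : ℝ) = ((F.L ^ 2 * M : ℕ) : ℝ) := by rw [hsS]
    push_cast at e; linarith
  have hspos : (0 : ℝ) < s := by exact_mod_cast hs1
  -- the scales
  obtain ⟨K, j, ε, θ₀, hεpos, hεa₀, hβε, hSP, hθP, hθ₀pos, hθL, hθL', hsθ⟩ := exists_flux_scale F hM ha₀ (le_max_right B₉ 1)
  have hsθ' : (s : ℝ) ^ 2 * θ₀ ≤ Real.pi := hsθ
  have hPerpos : 0 < (F.P K).sitesPerDir 0 := by omega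
  have hPerR : (0 : ℝ) < (F.P K).sitesPerDir 0 := by exact_mod_cast hPerpos
  -- the diagonal `D = D_{θ₀}` with `D^P = 1` and `dist1 D < ε/L²`
  obtain ⟨D, hD⟩ := exists_su_diag (N := N) hN θ₀
  have hDP : D ^ (F.P K).sitesPerDir 0 = 1 := by
    apply eq_one_of_dist1_eq_zero
    rw [hD]
    have e : ((F.P K).sitesPerDir 0 : ℝ) * θ₀ / 2 = (j : ℕ) * Real.pi := by rw [mul_comm, hθP]; ring
    rw [e, Real.sin_nat_mul_pi]; simp
  have hθ₀le : θ₀ ≤ ε / (F.L : ℝ) ^ 2 := by rw [le_div_iff₀ (by positivity)]; exact hθL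
  have hdistD : dist1 D < ε / (F.L : ℝ) ^ 2 := by
    have h1 := hD 1
    rw [pow_one, Nat.cast_one, one_mul] at h1
    rw [h1]
    have hθπ : θ₀ / 2 ≤ Real.pi := by
      have : θ₀ ≤ Real.pi :=
        calc θ₀ = 1 * θ₀ := (one_mul _).symm
          _ ≤ (s : ℝ) ^ 2 * θ₀ := mul_le_mul_of_nonneg_right (by nlinarith [(show (1 : ℝ) ≤ s by exact_mod_cast hs1)]) hθ₀pos.le
          _ ≤ Real.pi := hsθ'
      linarith
    have hsin0 : 0 ≤ Real.sin (θ₀ / 2) := Real.sin_nonneg_of_nonneg_of_le_pi (by linarith) hθπ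
    have hsinlt : Real.sin (θ₀ / 2) < θ₀ / 2 := Real.sin_lt (by linarith)
    rw [Real.norm_eq_abs, abs_of_nonneg (by linarith)]
    linarith
  -- the instance half
  obtain ⟨hB₉pos, hupper⟩ := dist1_pow_sq_le_of_gauge152OfClassTopStep hN hM h K hεpos hεa₀ hβε hSP hDP hdistD
  -- lower bound by Jordan's inequality
  have hlower : 2 / Real.pi * ((s : ℝ) ^ 2 * θ₀) ≤ dist1 (D ^ (s * s)) := by
    rw [hD (s * s)]
    have hsq : ((s * s : ℕ) : ℝ) * θ₀ / 2 = (s : ℝ) ^ 2 * θ₀ / 2 := by push_cast; ring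
    rw [hsq]
    have h0 : 0 ≤ (s : ℝ) ^ 2 * θ₀ / 2 := by positivity
    have hπ2 : (s : ℝ) ^ 2 * θ₀ / 2 ≤ Real.pi / 2 := by linarith [hsθ']
    have hj := Real.mul_le_sin h0 hπ2
    have hsin0 : 0 ≤ Real.sin ((s : ℝ) ^ 2 * θ₀ / 2) := le_trans (by positivity) hj
    rw [Real.norm_eq_abs, abs_of_nonneg (by linarith)]
    linarith
  have hη1 : (F.P K).eta 1 = ((F.L : ℝ))⁻¹ := by rw [Params.eta, T4Family.P_L, pow_one]
  have hchain : 2 / Real.pi * ((s : ℝ) ^ 2 * (ε / (2 * (F.L : ℝ) ^ 2))) ≤ ((4 * s : ℕ) : ℝ) * (2 * (((F.L : ℝ))⁻¹ * (B₉ * ε))) := by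
    rw [← hη1]
    have hθ₀ge : ε / (2 * (F.L : ℝ) ^ 2) ≤ θ₀ := by rw [div_le_iff₀ (by positivity)]; exact hθL'
    calc 2 / Real.pi * ((s : ℝ) ^ 2 * (ε / (2 * (F.L : ℝ) ^ 2))) ≤ 2 / Real.pi * ((s : ℝ) ^ 2 * θ₀) := by gcongr
      _ ≤ dist1 (D ^ (s * s)) := hlower
      _ ≤ _ := hupper
  -- `s ≤ 8π L B₉`
  have hfinal : (s : ℝ) ≤ 8 * Real.pi * F.L * B₉ := by
    have hπ0 : Real.pi ≠ 0 := Real.pi_ne_zero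
    have hL0 : (F.L : ℝ) ≠ 0 := ne_of_gt hLpos
    have e1 : Real.pi * (F.L : ℝ) ^ 2 * (2 / Real.pi * ((s : ℝ) ^ 2 * (ε / (2 * (F.L : ℝ) ^ 2)))) = (s : ℝ) ^ 2 * ε := by
      field_simp
    have e2 : Real.pi * (F.L : ℝ) ^ 2 * (((4 * s : ℕ) : ℝ) * (2 * (((F.L : ℝ))⁻¹ * (B₉ * ε)))) = 8 * Real.pi * F.L * B₉ * (s * ε) := by
      push_cast; field_simp; ring
    have h1 := mul_le_mul_of_nonneg_left hchain (by positivity : (0 : ℝ) ≤ Real.pi * (F.L : ℝ) ^ 2)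
    rw [e1, e2] at h1
    have hsε : 0 < (s : ℝ) * ε := by positivity
    by_contra hc
    rw [not_le] at hc
    nlinarith [h1, mul_pos hsε (sub_pos.2 hc)]
  linarith [hsR]

/-- **★★ CLEAN FORM: `Gauge152OfClassTopStep F N Sup M B₉ a₀ → F.L · M ≤ 26 · B₉`** (`N ≥ 2`, `M ≥ 1`, `0 < a₀`; `L ≥ 13` absorbs the `−1` and `8π·169∕168 < 26`).
[cite: Balaban1985Variational, (152) p.301; Balaban1985RegularSpaces, Thm 2 pp.82–83 (bookkeeping)] -/
theorem L_mul_le_of_gauge152OfClassTopStep (hN : 2 ≤ N) {Sup : (ν : Stage7Numerics) → (K : ℕ) → (ℕ → Set (Site (F.P K) 0)) → Set (Site (F.P K) 0)}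
    {M : ℕ} (hM : 1 ≤ M) {B₉ a₀ : ℝ} (ha₀ : 0 < a₀) (h : Gauge152OfClassTopStep F N Sup M B₉ a₀) : (F.L : ℝ) * M ≤ 26 * B₉ := by
  have h1 := sq_L_mul_sub_one_le_of_gauge152OfClassTopStep hN hM ha₀ h
  have hL13 : 13 ≤ F.L := by obtain ⟨hodd, _⟩ := F.hL; have := F.hL11; rcases hodd with ⟨r, hr⟩; omega
  have hLR : (13 : ℝ) ≤ F.L := by exact_mod_cast hL13
  have hMR : (1 : ℝ) ≤ M := by exact_mod_cast hM
  have hπ : Real.pi < 3.15 := Real.pi_lt_d2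
  have hLpos : (0 : ℝ) < F.L := by linarith
  have hLM : (13 : ℝ) ≤ (F.L : ℝ) * M := by nlinarith
  have hLLM : (169 : ℝ) ≤ (F.L : ℝ) ^ 2 * M := by nlinarith
  have hB : 0 < B₉ := by
    by_contra hb
    rw [not_lt] at hb
    have : 8 * Real.pi * F.L * B₉ ≤ 0 := mul_nonpos_of_nonneg_of_nonpos (by positivity) hb
    linarith
  have hLB : 0 < (F.L : ℝ) * B₉ := mul_pos hLpos hB
  have h25 : 8 * Real.pi * F.L * B₉ ≤ 25.2 * (F.L * B₉) := by nlinarith [hLB, hπ]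
  by_contra hc
  rw [not_le] at hc
  have h2 : 26 * (F.L * B₉) < (F.L : ℝ) ^ 2 * M := by nlinarith [hc, hLpos]
  nlinarith [h1, h25, h2, hLLM, hLB]

/-- Hence `¬ Gauge152OfClassTopStep F N Sup M B₉ a₀` whenever `26·B₉ < F.L·M` (`N ≥ 2`, `M ≥ 1`, `0 < a₀`) — e.g. at every `B₉ < L∕2`. [cite: Balaban1985Variational, (152) p.301 (bookkeeping)] -/
theorem not_gauge152OfClassTopStep_of_lt (hN : 2 ≤ N) {Sup : (ν : Stage7Numerics) → (K : ℕ) → (ℕ → Set (Site (F.P K) 0)) → Set (Site (F.P K) 0)}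
    {M : ℕ} (hM : 1 ≤ M) {B₉ a₀ : ℝ} (ha₀ : 0 < a₀) (hB : 26 * B₉ < (F.L : ℝ) * M) : ¬ Gauge152OfClassTopStep F N Sup M B₉ a₀ :=
  fun h => absurd (L_mul_le_of_gauge152OfClassTopStep hN hM ha₀ h) (not_le.mpr hB)

/-- **THE PRODUCT FLOOR ON dag-n07-e's ROAD TO (9) LINE 1** (`gauge9RegSepTopStep_of_prop8TopStep_of_gauge152` produces `Gauge9RegSepTopStep … B₃ (B₉·B₃) …`): its two inputs carry
`2L² ≤ B₃` (this lineage's FILE 22B `two_sq_L_le_of_prop8RegSepTopStep`, the corner engine) and `L·M ≤ 26·B₉` (above), so the (9)-constant that road delivers obeys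
`2L³·M ≤ 26·(B₉·B₃)`, i.e. `B₃' = B₉B₃ ≥ L³M∕13` — the letter any consumer FIXING `B₃'` on that road must respect. [cite: Balaban1985Variational, Prop. 8 p.304, (152) p.301, Thm 1 (9) p.279 (bookkeeping)] -/
theorem cube_L_mul_le_of_prop8TopStep_of_gauge152 (hN : 2 ≤ N) {Sup : (ν : Stage7Numerics) → (K : ℕ) → (ℕ → Set (Site (F.P K) 0)) → Set (Site (F.P K) 0)}
    {M : ℕ} (hM : 1 ≤ M) {B₃ B₉ a₀ a₀' a₁ : ℝ} (ha₀ : 0 < a₀) (ha₁ : 0 < a₁) (ha₀' : 0 < a₀')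
    (h8 : Prop8RegSepTopStep F N Sup B₃ a₀ a₁) (h152 : Gauge152OfClassTopStep F N Sup M B₉ a₀') :
    2 * (F.L : ℝ) ^ 3 * M ≤ 26 * (B₉ * B₃) := by
  have h1 := K0VariationalThm1Top7Engine.two_sq_L_le_of_prop8RegSepTopStep Sup hN ha₀ ha₁ h8
  have h2 := L_mul_le_of_gauge152OfClassTopStep hN hM ha₀' h152
  have hL : (0 : ℝ) ≤ F.L := by positivity
  have hM' : (0 : ℝ) ≤ M := by positivity
  have hB₉ : 0 ≤ 26 * B₉ := le_trans (by positivity) h2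
  have h3 := mul_le_mul h2 h1 (by positivity) hB₉
  nlinarith [h3]

end Floor

end Summit.QuantumFields.YangMills.Theorems.K0Gauge152FluxFloor

end
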